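import Summits.Langlands.Langlands.Theorems.IrreducibilityBySelfDualityIrreducibleOffSectorTransfer
import Summits.Langlands.Langlands.Theorems.IrreducibilityBySelfDualityIrreducibleGL3CMCyclotomicUntwist
import Summits.Langlands.Langlands.Theorems.IrreducibilityBySelfDualityReducibleForcesEssSelfDual
import Summits.Langlands.Langlands.Theorems.IrreducibilityBySelfDualityContragredientDatum
import Literature.NumberTheory.Automorphic.AlgebraicityParityGL
import Literature.NumberTheory.Automorphic.ArchParameterUnique
import Literature.NumberTheory.GaloisRepresentations.WeakAbelianDirectSummandCyclotomicProofs
import HarnessLib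

/-!
# `IrreducibleOffSector` in rank three over EVERY number field, regular `π`: the generic
# (not essentially self-dual) case
(crux stmt-Langlands-14329 `IrreducibilityBySelfDuality.IrreducibleOffSector`, line `Sketch`;
`--supports` file, STRUCTURAL: no import of the route module)

The route's support `ReducibleForcesEssSelfDual` (Böckle–Hui 2025 §3.2.1 made field-independent;
PROVED, `reducibleForcesEssSelfDual_of`, p82603) says: for ANY number field `K`, `π` regular algebraic
cuspidal on `GL_3(𝔸_K)` and `r : Γ_K → GL_3(ℚ̄_ℓ)` semisimple and compatible with `(π, ι)` at almost all
places in the C-normalisation, if `r` is reducible then `π` is ESSENTIALLY SELF-DUAL at Satake level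
(there is a cuspidal `GL(1)` datum `η` with `t_{π,v}⁻¹ = η(ϖ_v) · t_{π,v}` a.e.: a stable line is an
algebraic Hecke character by Böckle–Hui Thm. 1.1 + Clozel's Hecke field, and the Jacquet–Shalika pole
calculus `∧² = contragredient ⊗ det` forces `π^∨ ≅ π ⊗ μ⁻²`).  Its inputs are the route texts
`WeakAbelianSummandHecke` (a theorem of the tree), `HeckeEigenvalueField` (Clozel 1990 Thm. 3.13),
`PairLBoundaryJS` (Arthur–Clozel (2.2)) and `ContragredientDatum` (PROVED, `ContragredientDatum_proof`).

Combined with the frame of the sector theorem (regular + L-algebraic in odd rank ⇒ regular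
algebraic; cyclotomic untwist `stub_cyclotomicUntwist` to the C-normalisation; continuous
semisimplification; Brauer–Nesbitt), this gives the GENERIC REGION of the crux in rank three over
every number field:

* `isIrreducible_rank_three_of_isRegular_of_not_essSelfDual` — `K` ANY number field, `π` cuspidal on
  `GL_3(𝔸_K)`, L-algebraic with a regular infinity type and NOT essentially self-dual at Satake
  level; then every `ρ : Γ_K → GL_3(ℚ̄_ℓ)` Satake–Frobenius compatible with `(π, ι)` at almost all
  places is irreducible — modulo the texts of `WeakAbelianSummandHecke`, `HeckeEigenvalueField` and
  Arthur–Clozel (2.2) only (no Galois representation is constructed, no self-dual descent, no CM /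
  totally-real hypothesis).

So in rank three with `π` regular the open content of the crux is the ESSENTIALLY SELF-DUAL case
over fields that are neither CM (the route's sector theorem `IrreducibleGL3CM`) nor totally real
(Böckle–Hui 2025 Thm. 1.2, `isIrreducible_rank_three_totallyReal_of_isRegular`, p117071): after
Ramakrishnan's descent `π ≃ Ad(σ₀) ⊗ ν` this is the case where no regular algebraic member of the
twist class of `σ₀` need exist (the lever `HalfIntegralTwistCM` is false off CM fields).

References: G. Böckle, C.-Y. Hui, Math. Ann. 393 (2025), Thm. 1.1, §3.2.1; H. Jacquet, J. Shalika,
Amer. J. Math. 103 (1981) II, Thm. 4.4; L. Clozel, *Motifs et formes automorphes* (1990), Thm. 3.13;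
D. Ramakrishnan, *An exercise concerning the selfdual cusp forms on GL(3)* (2014), Thm. A.
-/

noncomputable section

set_option linter.dupNamespace false

open scoped NumberField Classical
open Filter IsDedekindDomain NumberField
open Literature.NumberTheory.Automorphic Literature.NumberTheory.GaloisRepresentations
open Summit.Langlands

namespace Summit.Langlands.Langlands.Theorems.IrreducibleOffSector

/-- **`IrreducibleOffSector` in rank three, any number field, regular and NOT essentially self-dual
`π`** (the generic region of the crux in rank three).  Grant Böckle–Hui 2025 Thm. 1.1 in cofinite
`GL(1)` form (the text of the route item `WeakAbelianSummandHecke`, a theorem of the tree), Clozel's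
Hecke field (the text of the input `HeckeEigenvalueField`) and Arthur–Clozel (2.2) for Borel–Jacquet
data.  Let `K` be ANY number field, `π` cuspidal on `GL_3(𝔸_K)`, L-algebraic with a regular infinity
type, and suppose `π` is not essentially self-dual at Satake level: there is no cuspidal `GL(1)` datum
`η` (at the level witness `h1`) with `t_{π,v}⁻¹ = η(ϖ_v) · t_{π,v}` for almost all `v`.  Then every
`ρ : Γ_K → GL_3(ℚ̄_ℓ)` Satake–Frobenius compatible with `(π, ι)` at almost all places is irreducible.
Proof: `π` is regular algebraic (odd rank); pass to the cyclotomic untwist `ρ'` (compatible a.e. in the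
C-normalisation) and to a continuous semisimplification `r` of `ρ'`; if `ρ` were reducible so would be
`r`, and `reducibleForcesEssSelfDual_of` (fed with the three texts and the proved
`ContragredientDatum_proof`) would make `π` essentially self-dual.
[cite: BockleHui2025, Theorem 1.1 and §3.2.1] [cite: JacquetShalikaAJM1981II, Thm. 4.4] -/
theorem isIrreducible_rank_three_of_isRegular_of_not_essSelfDual
    (hWA : ∀ (K : Type) [Field K] [NumberField K] (h1 : isCompact_glFiniteIntegralLevel 1 K) (ℓ : ℕ) [Fact ℓ.Prime] (n : ℕ) (E : Type) [Field E] [NumberField E] (e : E →+* PadicAlgCl ℓ) (ρ : Literature.NumberTheory.GaloisRepresentations.FramedGaloisRep K (PadicAlgCl ℓ) n), ρ.toGaloisRep.IsSemisimple → (∀ᶠ v in cofinite, ρ.IsUnramifiedAt v ∧ ∃ P : Polynomial E, ρ.HasFrobCharpolyAt v (P.map e)) → ∀ (ψ : Literature.NumberTheory.GaloisRepresentations.FramedGaloisRep K (PadicAlgCl ℓ) 1), (∀ᶠ v in cofinite, ρ.IsUnramifiedAt v ∧ ψ.IsUnramifiedAt v ∧ ∀ 𝔓 ∈ v.primesAbove,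 ∀ σ : Field.absoluteGaloisGroup K, IsArithFrobAt (NumberField.RingOfIntegers K) σ 𝔓 → ψ.charpoly σ ∣ ρ.charpoly σ) → ∀ (ι : PadicAlgCl ℓ ≃+* ℂ), ∃ χ : Literature.NumberTheory.Automorphic.CuspidalAutomorphicRepData 1 K h1, χ.1.IsRegularAlgebraic ∧ ∀ᶠ v in cofinite, ∃ c : ℂ, χ.1.HasSatakeParamAt v {c} ∧ ψ.IsUnramifiedAt v ∧ ψ.HasFrobCharpolyAt v (Literature.NumberTheory.Automorphic.arithFrobPolyOfSatake ι v.residueCard 1 {c}))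
    (hHE : ∀ (n : ℕ) (K : Type) [Field K] [NumberField K] (hcpt : Literature.NumberTheory.Automorphic.isCompact_glFiniteIntegralLevel n K) (π : Literature.NumberTheory.Automorphic.CuspidalAutomorphicRepData n K hcpt), π.1.IsRegularAlgebraic → ∃ E : Subfield ℂ, FiniteDimensional ℚ E ∧ ∀ᶠ v in cofinite, ∀ α : Multiset ℂ, π.1.HasSatakeParamAt v α → ∀ i ≤ n, ((((Real.sqrt (v.residueCard : ℝ)) : ℝ) : ℂ) ^ (i * (n - i))) * α.esymm i ∈ E)
    (h22 : JacquetShalika1981_partialPairL_boundary_repData)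
    {K : Type} [Field K] [NumberField K] (h1 : isCompact_glFiniteIntegralLevel 1 K)
    {hcpt : isCompact_glFiniteIntegralLevel 3 K}
    (π : CuspidalAutomorphicRepData 3 K hcpt) (hL : π.1.IsLAlgebraic)
    (hreg : ∃ T : InfinityType K 3, π.1.HasInfinityType T ∧ T.IsRegular)
    (hnsd : ∀ η : CuspidalAutomorphicRepData 1 K h1,
      ¬ ∀ᶠ v : HeightOneSpectrum (𝓞 K) in cofinite, ∀ α : Multiset ℂ, π.1.HasSatakeParamAt v α →
        ∃ e : ℂ, η.1.HasSatakeParamAt v {e} ∧ α.map (fun a => a⁻¹) = α.map (fun a => e * a))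
    {ℓ : ℕ} [Fact ℓ.Prime] (ι : PadicAlgCl ℓ ≃+* ℂ) (ρ : FramedGaloisRep K (PadicAlgCl ℓ) 3)
    (hρ : ∀ᶠ v : HeightOneSpectrum (𝓞 K) in cofinite, SatakeFrobCompatibleAt ι π.1 ρ v) :
    ρ.toGaloisRep.IsIrreducible := by
  -- (i) regular algebraicity: `3` is odd
  have hRA : π.1.IsRegularAlgebraic := by
    obtain ⟨T₁, hT₁, hL₁⟩ := hL
    obtain ⟨T₂, hT₂, hR₂⟩ := hreg
    refine ⟨T₁, hT₁, ?_, fun σ => ?_⟩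
    · exact (InfinityType.isCAlgebraic_iff_isLAlgebraic_of_odd (by decide : Odd 3) T₁).mpr hL₁
    · rw [AutomorphicRepData.HasInfinityType.map_a_eq π.1 hT₁ hT₂ σ]
      exact hR₂ σ
  -- (ii) the cyclotomic untwist, compatible a.e. in the `m = 3` normalisation
  obtain ⟨ρ', himp, hρ'v⟩ := IrreducibleGL3CM.stub_cyclotomicUntwist K ℓ ι ρ
  have hρ' : ∀ᶠ v : HeightOneSpectrum (𝓞 K) in cofinite, ∀ α : Multiset ℂ, π.1.HasSatakeParamAt v α →
      ρ'.IsUnramifiedAt v ∧ ρ'.HasFrobCharpolyAt v (arithFrobPolyOfSatake ι v.residueCard 3 α) := by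
    filter_upwards [hρ, FramedGaloisRep.eventually_natCast_not_mem K ℓ] with v hv hℓ
    obtain ⟨α₀, hα₀, hur, hcp⟩ := hv
    intro α hα
    obtain rfl : α = α₀ := AutomorphicRepData.hasSatakeParamAt_unique_holds π.1 hα hα₀
    obtain ⟨hur', hcp'⟩ := hρ'v v hℓ hur
    exact ⟨hur', hcp' α hcp⟩
  -- (iii) a continuous semisimplification of the untwist, still compatible a.e.
  obtain ⟨r, hrss, hrcp, hrker⟩ := IrreducibleGL3CM.stub_continuousSemisimplification K ℓ 3 ρ'
  have hr : ∀ᶠ v : HeightOneSpectrum (𝓞 K) in cofinite, ∀ α : Multiset ℂ, π.1.HasSatakeParamAt v α →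
      r.IsUnramifiedAt v ∧ r.HasFrobCharpolyAt v (arithFrobPolyOfSatake ι v.residueCard 3 α) := by
    filter_upwards [hρ'] with v hv α hα
    obtain ⟨hur, hcp⟩ := hv α hα
    exact ⟨fun 𝔓 h𝔓 σ hσ => hrker σ (hur 𝔓 h𝔓 σ hσ),
      fun 𝔓 h𝔓 σ hσ => (hrcp σ).trans (hcp 𝔓 h𝔓 σ hσ)⟩
  -- (iv) a reducible avatar would make `π` essentially self-dual
  by_contra hirr
  have hρ'irr : ¬ ρ'.toGaloisRep.IsIrreducible := fun h' => hirr (himp h')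
  have hrirr : ¬ r.toGaloisRep.IsIrreducible :=
    IrreducibleGL3CM.stub_not_isIrreducible_of_charpoly_eq K ℓ 3 ρ' r hrss hrcp hρ'irr
  obtain ⟨hess, -⟩ := ReducibleForcesEssSelfDual.reducibleForcesEssSelfDual_of hWA hHE h22
    ContragredientDatum.ContragredientDatum_proof K h1 hcpt π hRA ℓ ι r hrss hr
  obtain ⟨η, hη⟩ := hess hrirr
  exact hnsd η hη

end Summit.Langlands.Langlands.Theorems.IrreducibleOffSector

end
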